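import Summits.CriticalPhenomena.PercolationContinuityZ3.Theorems.Transplant.SkelPhiRunKitClauseHab
import Summits.CriticalPhenomena.PercolationContinuityZ3.Theorems.Transplant.SkelPhiParaVLocDChain
import HarnessLib

/-!
# N1 (the `{±1}` node), LEVEL 1, (C) column under S1 (C-STEP0.md §4–§5): THE ROUTE SETS (clause (h3) of p1's `kitClause_runXHab`) OF THE THREE STEP
# KINDS OF THE ONE-FRAME CORRIDOR in `runX φ c₀ n h 1` over a habitat — signed v-rounds (`vLocPrmD`, steered top piece of the centre-bound stride),
# u-rounds (`xLocPrm`, steered side half of the centre-bound stride), the signed x-band (`xPrmW`, sign `σB`) and the signed y′-band (`yPrmX`, sign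
# `σB`, drift `v`): `Qt := pgramPrismFin c n h (3ℓ) Rl`, `Ft :=` the steered piece, `Ft ⊆ T`, `Qt ⊆ Dr`, `Ft` off the zone box, and the Step-I″
# certificate at `c` transferred to the subbox weighting of `winGraphIn G Ω` — p1's `routeSetsN_xIn` with my route readings (p280414, p287707, VLocD).

builds on p205010 (kernel theorem, internal audit signed; external expert review pending) — nothing in this file uses p205010; nothing here is a
claim about the open node `SamePDropOfSkeletonNeg`.
Lane `prim-bschramm`, seat `prim-bschramm-p5` (gen 9; (C) lineage); helper file (`--supports stmt-CriticalPhenomena-4575`).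
* **`routeSetsN_vlocDIn`**, **`routeSetsN_locIn`**, **`routeSetsN_xbandIn`**, **`routeSetsN_ybandIn`**.
[cite: KozmaNitzan2024, §4 Lemma 10 Step IV (pp. 20–21), Lemma 11 (pp. 22–23), Lemma 12 (pp. 23–25)] [cite: MartineauTassion2017, §4.3 Lemma 4.2]
-/

noncomputable section

open scoped Classical

namespace Summit.CriticalPhenomena.PercolationContinuityZ3.Theorems.Transplant

namespace Skelφ

open MeasureTheory ProbabilityTheory
open Literature.Probability.Percolation Literature.Probability.LatticeModels SimpleGraph KNLevels
open Literature.Barriers.CriticalPhenomena (graphBall graphBall_mono)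
open Skel (winGraph winGraph_le winGraphIn winGraphIn_le)
open ChainPlanar ChainPara

variable {V : Type} {G : SimpleGraph V} {φ : V → Site 2}

/-- The common last step: a certified link inside `Qt = pgramPrismFin c …` with `Qt ⊆ Dr ⊆ Ω` transfers from `P_q` to the subbox weighting of the habitat graph.
[cite: KozmaNitzan2024, §4 Lemma 10 Step IV (p. 21)] -/
private theorem transfer_prismFin [DecidableEq V] [Countable V] [G.LocallyFinite] {c : V} {n : ℕ} {h : ℤ} {ℓ Rl : ℕ} {Dr Ω : Finset V}
    (hQD : pgramPrismFin G φ c n h (3 * ℓ) Rl ⊆ Dr) (hDrΩ : Dr ⊆ Ω) {q : unitInterval} {Wt : Sym2 V → unitInterval} (hWD : IsSubbox (winGraphIn G Ω) Wt q Dr)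
    (SEED Ft : Finset V) (hFt : (↑Ft : Set V) ⊆ pgramPrism G φ c n h (3 * ℓ) Rl) {δ₂ : ℝ}
    (hev : 1 - δ₂ < (bondPercolation G q).real (linkIn (pgramPrism G φ c n h (3 * ℓ) Rl) SEED Ft)) :
    1 - δ₂ < (prodBernoulli Wt).real (linkIn (↑(pgramPrismFin G φ c n h (3 * ℓ) Rl) : Set V) SEED Ft) := by
  have hcoe : (↑(pgramPrismFin G φ c n h (3 * ℓ) Rl) : Set V) = pgramPrism G φ c n h (3 * ℓ) Rl := by ext w; simp
  have _ := hFt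
  have heq := Skel.real_eq_of_isSubbox_of_le (winGraphIn_le G Ω) hWD hQD (Skel.adj_winGraphIn_of_subset (hQD.trans hDrΩ))
    (determinedBy_linkIn (↑(pgramPrismFin G φ c n h (3 * ℓ) Rl)) SEED Ft subset_rfl) (measurableSet_linkIn _ _ _)
  rw [heq, hcoe]
  exact hev

/-- **THE ROUTE SETS OF A CENTRE-BOUND v-STRIDE (signed v-rounds, segment A)**: `Qt := pgramPrismFin c n h (3ℓ) Rl`, `Ft := pgTopPieceW c n h ℓ Rl σ_w τ₀ v` with
`σ_w = dir (runX c 1)`, `τ₀ = steerT σ_w (runX c 0)`; `Ft ⊆ T`, `Qt ⊆ Dr`, `Ft` off the zone box (clearance `(Mz+4)(n+|h|) ≤ n(ℓ+1)`), certificate transferred.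
[cite: KozmaNitzan2024, §4 Lemma 10 Step IV (pp. 20–21), Lemma 12 (pp. 23–25)] [cite: MartineauTassion2017, §4.3 Lemma 4.2] -/
theorem routeSetsN_vlocDIn [DecidableEq V] [Countable V] [G.LocallyFinite] {n ℓ : ℕ} {h v : ℤ} {e W : ℕ} (hn : 1 ≤ n) (hv : |v| ≤ n) (hW : n ≤ W)
    (he : ((e : ℤ) + 2) * ((n + h.natAbs : ℕ) : ℤ) ≤ (n : ℤ) * ℓ + 1) (L0 N : ℕ) (c₀ : V) {w₀ c : V} {R r Rl k Mz : ℕ}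
    (hc : runX φ c₀ n h 1 c ∈ Finset.Icc
      (((vLocPrmD n ℓ h v e W L0 N).scheduleN 1 0 (vLocPrmD_ok hn hv hW he L0 N) (vLocPrmD_dL hv e W L0 N)).lo k -
        ((((vLocPrmD n ℓ h v e W L0 N).scheduleN 1 0 (vLocPrmD_ok hn hv hW he L0 N) (vLocPrmD_dL hv e W L0 N)).R' : ℕ) : Site 2))
      (((vLocPrmD n ℓ h v e W L0 N).scheduleN 1 0 (vLocPrmD_ok hn hv hW he L0 N) (vLocPrmD_dL hv e W L0 N)).hi k +
        ((((vLocPrmD n ℓ h v e W L0 N).scheduleN 1 0 (vLocPrmD_ok hn hv hW he L0 N) (vLocPrmD_dL hv e W L0 N)).R' : ℕ) : Site 2)))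
    (hcw : c ∈ graphBall G w₀ (R - r)) (hr : Rl ≤ r) (hrR : r ≤ R) {Z : Finset V} (hZ : (↑Z : Set V) ⊆ cyl φ c Mz)
    (hclear : (Mz + 4) * (n + h.natAbs) ≤ n * (ℓ + 1))
    {Dr T : Finset V}
    (hPD : Win G (runX φ c₀ n h 1) w₀ (((vLocPrmD n ℓ h v e W L0 N).scheduleN 1 0 (vLocPrmD_ok hn hv hW he L0 N) (vLocPrmD_dL hv e W L0 N)).region k) R ⊆ Dr)
    (hPT : Win G (runX φ c₀ n h 1) w₀ (((vLocPrmD n ℓ h v e W L0 N).scheduleN 1 0 (vLocPrmD_ok hn hv hW he L0 N) (vLocPrmD_dL hv e W L0 N)).core (k + 1)) R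
      ⊆ T)
    {Ω : Finset V} (hDrΩ : Dr ⊆ Ω) {q : unitInterval} {Wt : Sym2 V → unitInterval} (hWD : IsSubbox (winGraphIn G Ω) Wt q Dr) {SEED : Finset V} {δ₂ : ℝ}
    (hev : 1 - δ₂ < (bondPercolation G q).real (linkIn (pgramPrism G φ c n h (3 * ℓ) Rl) SEED
      (pgTopPieceW G φ c n h ℓ Rl (LocPrm.dir (runX φ c₀ n h 1 c 1)) (LocPrm.steerT (LocPrm.dir (runX φ c₀ n h 1 c 1)) (runX φ c₀ n h 1 c 0)) v))) :
    ∃ Qt Ft : Finset V, Ft ⊆ T ∧ Qt ⊆ Dr ∧ Disjoint Ft Z ∧ 1 - δ₂ < (prodBernoulli Wt).real (linkIn (↑Qt : Set V) SEED Ft) := by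
  set σw := LocPrm.dir (runX φ c₀ n h 1 c 1) with hσw
  set τ₀ := LocPrm.steerT σw (runX φ c₀ n h 1 c 0) with hτ₀
  have hσ : σw = 1 ∨ σw = -1 := LocPrm.dir_eq_or _
  have hQB : ∀ w ∈ pgramPrism G φ c n h (3 * ℓ) Rl, w ∈ graphBall G w₀ R := fun w hw =>
    pgramPrism_subset_graphBall_of_mem hcw hr hrR n h (3 * ℓ) hw
  have hQD : pgramPrismFin G φ c n h (3 * ℓ) Rl ⊆ Dr := fun w hw => by
    have hw' := (mem_pgramPrismFin G φ).1 hw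
    exact hPD ((mem_Win G _).2 ⟨hQB w hw', runX_mem_vlocDRegion_of_link hn hv hW he L0 N c₀ hc hw'⟩)
  have hFt : (↑(pgTopPieceW G φ c n h ℓ Rl σw τ₀ v) : Set V) ⊆ pgramPrism G φ c n h (3 * ℓ) Rl := coe_pgTopPieceW_subset (G := G) (φ := φ) c n h ℓ Rl σw τ₀ v
  refine ⟨pgramPrismFin G φ c n h (3 * ℓ) Rl, pgTopPieceW G φ c n h ℓ Rl σw τ₀ v, fun w hw => ?_, hQD, ?_,
    transfer_prismFin hQD hDrΩ hWD SEED _ hFt hev⟩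
  · have hw' : w ∈ pgramPrism G φ c n h (3 * ℓ) Rl := hFt (Finset.mem_coe.2 hw)
    exact hPT ((mem_Win G _).2 ⟨hQB w hw', runX_mem_vlocDCore_succ_of_piece hn hv hW he L0 N c₀ hc hw⟩)
  · have hd := disjoint_pgTopPieceW_cyl (G := G) (φ := φ) c hn hclear Rl hσ τ₀ v
    exact Finset.disjoint_left.2 fun w hw hz => Set.disjoint_left.1 hd (Finset.mem_coe.2 hw) (hZ (Finset.mem_coe.2 hz))

/-- **THE ROUTE SETS OF A CENTRE-BOUND u-STRIDE (u-rounds, segment B)**: `Qt := pgramPrismFin c n h (3ℓ) Rl`, `Ft := pgSideHalfW c n h ℓ Rl σ_w (σ_w·τ₀)` with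
`σ_w = dir (runX c 0)`, `τ₀ = steerT σ_w (runX c 1)`; `Ft ⊆ T`, `Qt ⊆ Dr`, `Ft` off the zone box (`Mz < n`), certificate transferred.
[cite: KozmaNitzan2024, §4 Lemma 10 Step IV (pp. 20–21), Lemma 12 (pp. 23–25)] [cite: MartineauTassion2017, §4.3 Lemma 4.2] -/
theorem routeSetsN_locIn [DecidableEq V] [Countable V] [G.LocallyFinite] {n ℓ : ℕ} {h : ℤ} {e W : ℕ} (hn : 1 ≤ n) (he : e ≤ n)
    (hW : n * ℓ / shearUnit n h + 1 ≤ W) (L0 N : ℕ) (c₀ : V) {w₀ c : V} {R r Rl k Mz : ℕ}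
    (hc : runX φ c₀ n h 1 c ∈ Finset.Icc (((xLocPrm n ℓ h e W L0 N).scheduleN 0 0 (xLocPrm_ok he hW L0 N)).lo k -
        ((((xLocPrm n ℓ h e W L0 N).scheduleN 0 0 (xLocPrm_ok he hW L0 N)).R' : ℕ) : Site 2))
      (((xLocPrm n ℓ h e W L0 N).scheduleN 0 0 (xLocPrm_ok he hW L0 N)).hi k + ((((xLocPrm n ℓ h e W L0 N).scheduleN 0 0 (xLocPrm_ok he hW L0 N)).R' : ℕ) : Site 2)))
    (hcw : c ∈ graphBall G w₀ (R - r)) (hr : Rl ≤ r) (hrR : r ≤ R) {Z : Finset V} (hZ : (↑Z : Set V) ⊆ cyl φ c Mz) (hMz : Mz < n)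
    {Dr T : Finset V} (hPD : Win G (runX φ c₀ n h 1) w₀ (((xLocPrm n ℓ h e W L0 N).scheduleN 0 0 (xLocPrm_ok he hW L0 N)).region k) R ⊆ Dr)
    (hPT : Win G (runX φ c₀ n h 1) w₀ (((xLocPrm n ℓ h e W L0 N).scheduleN 0 0 (xLocPrm_ok he hW L0 N)).core (k + 1)) R ⊆ T)
    {Ω : Finset V} (hDrΩ : Dr ⊆ Ω) {q : unitInterval} {Wt : Sym2 V → unitInterval} (hWD : IsSubbox (winGraphIn G Ω) Wt q Dr) {SEED : Finset V} {δ₂ : ℝ}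
    (hev : 1 - δ₂ < (bondPercolation G q).real (linkIn (pgramPrism G φ c n h (3 * ℓ) Rl) SEED
      (pgSideHalfW G φ c n h ℓ Rl (LocPrm.dir (runX φ c₀ n h 1 c 0))
        (LocPrm.dir (runX φ c₀ n h 1 c 0) * LocPrm.steerT (LocPrm.dir (runX φ c₀ n h 1 c 0)) (runX φ c₀ n h 1 c 1))))) :
    ∃ Qt Ft : Finset V, Ft ⊆ T ∧ Qt ⊆ Dr ∧ Disjoint Ft Z ∧ 1 - δ₂ < (prodBernoulli Wt).real (linkIn (↑Qt : Set V) SEED Ft) := by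
  set σw := LocPrm.dir (runX φ c₀ n h 1 c 0) with hσw
  set τ₀ := LocPrm.steerT σw (runX φ c₀ n h 1 c 1) with hτ₀
  have hσ : σw = 1 ∨ σw = -1 := LocPrm.dir_eq_or _
  have hQB : ∀ w ∈ pgramPrism G φ c n h (3 * ℓ) Rl, w ∈ graphBall G w₀ R := fun w hw =>
    pgramPrism_subset_graphBall_of_mem hcw hr hrR n h (3 * ℓ) hw
  have hQD : pgramPrismFin G φ c n h (3 * ℓ) Rl ⊆ Dr := fun w hw => by
    have hw' := (mem_pgramPrismFin G φ).1 hw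
    exact hPD ((mem_Win G _).2 ⟨hQB w hw', runX_mem_locRegion_of_link hn he hW L0 N c₀ hc hw'⟩)
  have hFt : (↑(pgSideHalfW G φ c n h ℓ Rl σw (σw * τ₀)) : Set V) ⊆ pgramPrism G φ c n h (3 * ℓ) Rl :=
    coe_pgSideHalfW_subset (G := G) (φ := φ) c n h ℓ Rl σw _
  refine ⟨pgramPrismFin G φ c n h (3 * ℓ) Rl, pgSideHalfW G φ c n h ℓ Rl σw (σw * τ₀), fun w hw => ?_, hQD, ?_,
    transfer_prismFin hQD hDrΩ hWD SEED _ hFt hev⟩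
  · have hw' : w ∈ pgramPrism G φ c n h (3 * ℓ) Rl := hFt (Finset.mem_coe.2 hw)
    exact hPT ((mem_Win G _).2 ⟨hQB w hw', runX_mem_locCore_succ_of_piece hn he hW L0 N c₀ hc hw⟩)
  · have hd := disjoint_pgSideHalfW_cyl (G := G) (φ := φ) c hMz h ℓ Rl hσ (σw * τ₀)
    exact Finset.disjoint_left.2 fun w hw hz => Set.disjoint_left.1 hd (Finset.mem_coe.2 hw) (hZ (Finset.mem_coe.2 hz))

/-- **THE ROUTE SETS OF A SIGNED x-BAND STRIDE (segment C, u-corridor)**: band sign `σB`, `Ft := pgSideHalfW c n h ℓ Rl σB (σB·τₖ)` with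
`τₖ = steer k (σB·runX c 1)`; `Ft ⊆ T`, `Qt ⊆ Dr`, `Ft` off the zone box (`Mz < n`), certificate transferred.
[cite: KozmaNitzan2024, §4 Lemma 10 Step IV (pp. 20–21), Lemma 11 (pp. 22–23)] [cite: MartineauTassion2017, §4.3 Lemma 4.2] -/
theorem routeSetsN_xbandIn [DecidableEq V] [Countable V] [G.LocallyFinite] {n ℓ : ℕ} (hn : 1 ≤ n) (c₀ : V) (h : ℤ) {σB : ℤ} (hσB : σB = 1 ∨ σB = -1)
    (R' qB N : ℕ) {w₀ c : V} {R r Rl k Mz : ℕ}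
    (hc : runX φ c₀ n h 1 c ∈ Finset.Icc (((xPrmW n ℓ h R' qB N).scheduleN 0 hσB 0 (xPrmW_ok n ℓ h R' qB N) (xPrmW_eb n ℓ h R' qB N)).lo k -
        ((((xPrmW n ℓ h R' qB N).scheduleN 0 hσB 0 (xPrmW_ok n ℓ h R' qB N) (xPrmW_eb n ℓ h R' qB N)).R' : ℕ) : Site 2))
      (((xPrmW n ℓ h R' qB N).scheduleN 0 hσB 0 (xPrmW_ok n ℓ h R' qB N) (xPrmW_eb n ℓ h R' qB N)).hi k +
        ((((xPrmW n ℓ h R' qB N).scheduleN 0 hσB 0 (xPrmW_ok n ℓ h R' qB N) (xPrmW_eb n ℓ h R' qB N)).R' : ℕ) : Site 2)))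
    (hcw : c ∈ graphBall G w₀ (R - r)) (hr : Rl ≤ r) (hrR : r ≤ R) {Z : Finset V} (hZ : (↑Z : Set V) ⊆ cyl φ c Mz) (hMz : Mz < n)
    {Dr T : Finset V}
    (hPD : Win G (runX φ c₀ n h 1) w₀ (((xPrmW n ℓ h R' qB N).scheduleN 0 hσB 0 (xPrmW_ok n ℓ h R' qB N) (xPrmW_eb n ℓ h R' qB N)).region k) R ⊆ Dr)
    (hPT : Win G (runX φ c₀ n h 1) w₀ (((xPrmW n ℓ h R' qB N).scheduleN 0 hσB 0 (xPrmW_ok n ℓ h R' qB N) (xPrmW_eb n ℓ h R' qB N)).core (k + 1)) R ⊆ T)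
    {Ω : Finset V} (hDrΩ : Dr ⊆ Ω) {q : unitInterval} {Wt : Sym2 V → unitInterval} (hWD : IsSubbox (winGraphIn G Ω) Wt q Dr) {SEED : Finset V} {δ₂ : ℝ}
    (hev : 1 - δ₂ < (bondPercolation G q).real (linkIn (pgramPrism G φ c n h (3 * ℓ) Rl) SEED
      (pgSideHalfW G φ c n h ℓ Rl σB (σB * (xPrmW n ℓ h R' qB N).steer k (σB * runX φ c₀ n h 1 c 1))))) :
    ∃ Qt Ft : Finset V, Ft ⊆ T ∧ Qt ⊆ Dr ∧ Disjoint Ft Z ∧ 1 - δ₂ < (prodBernoulli Wt).real (linkIn (↑Qt : Set V) SEED Ft) := by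
  set τ₀ := (xPrmW n ℓ h R' qB N).steer k (σB * runX φ c₀ n h 1 c 1) with hτ₀
  have hQB : ∀ w ∈ pgramPrism G φ c n h (3 * ℓ) Rl, w ∈ graphBall G w₀ R := fun w hw =>
    pgramPrism_subset_graphBall_of_mem hcw hr hrR n h (3 * ℓ) hw
  have hQD : pgramPrismFin G φ c n h (3 * ℓ) Rl ⊆ Dr := fun w hw => by
    have hw' := (mem_pgramPrismFin G φ).1 hw
    exact hPD ((mem_Win G _).2 ⟨hQB w hw', runX_mem_xbandRegion_of_link hn c₀ h hσB R' qB N hc hw'⟩)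
  have hFt : (↑(pgSideHalfW G φ c n h ℓ Rl σB (σB * τ₀)) : Set V) ⊆ pgramPrism G φ c n h (3 * ℓ) Rl :=
    coe_pgSideHalfW_subset (G := G) (φ := φ) c n h ℓ Rl σB _
  refine ⟨pgramPrismFin G φ c n h (3 * ℓ) Rl, pgSideHalfW G φ c n h ℓ Rl σB (σB * τ₀), fun w hw => ?_, hQD, ?_,
    transfer_prismFin hQD hDrΩ hWD SEED _ hFt hev⟩
  · have hw' : w ∈ pgramPrism G φ c n h (3 * ℓ) Rl := hFt (Finset.mem_coe.2 hw)
    exact hPT ((mem_Win G _).2 ⟨hQB w hw', runX_mem_xbandCore_succ_of_piece hn c₀ h hσB R' qB N hc hw⟩)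
  · have hd := disjoint_pgSideHalfW_cyl (G := G) (φ := φ) c hMz h ℓ Rl hσB (σB * τ₀)
    exact Finset.disjoint_left.2 fun w hw hz => Set.disjoint_left.1 hd (Finset.mem_coe.2 hw) (hZ (Finset.mem_coe.2 hz))

/-- **THE ROUTE SETS OF A SIGNED y′-BAND STRIDE (segment C, v-corridor)**: band sign `σB`, drift `v`, `Ft := pgTopPieceW c n h ℓ Rl σB τₖ v` with
`τₖ = steer k (σB·runX c 0)`; `Ft ⊆ T`, `Qt ⊆ Dr`, `Ft` off the zone box (clearance `(Mz+4)(n+|h|) ≤ n(ℓ+1)`), certificate transferred.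
[cite: KozmaNitzan2024, §4 Lemma 10 Step IV (pp. 20–21), Lemma 11 (pp. 22–23)] [cite: MartineauTassion2017, §4.3 Lemma 4.2] -/
theorem routeSetsN_ybandIn [DecidableEq V] [Countable V] [G.LocallyFinite] {n ℓ : ℕ} {h v : ℤ} (hn : 1 ≤ n) (hv : |v| ≤ n)
    (hlay : 2 * ((n + h.natAbs : ℕ) : ℤ) ≤ (n : ℤ) * ℓ + 1) (c₀ : V) {σB : ℤ} (hσB : σB = 1 ∨ σB = -1) (R' qB N : ℕ) {w₀ c : V} {R r Rl k Mz : ℕ}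
    (hc : runX φ c₀ n h 1 c ∈ Finset.Icc
      (((yPrmX n ℓ h v R' qB N).scheduleN 1 hσB 0 (yPrmX_ok hn hv hlay R' qB N) (yPrmX_eb n ℓ h v R' qB N)).lo k -
        ((((yPrmX n ℓ h v R' qB N).scheduleN 1 hσB 0 (yPrmX_ok hn hv hlay R' qB N) (yPrmX_eb n ℓ h v R' qB N)).R' : ℕ) : Site 2))
      (((yPrmX n ℓ h v R' qB N).scheduleN 1 hσB 0 (yPrmX_ok hn hv hlay R' qB N) (yPrmX_eb n ℓ h v R' qB N)).hi k +
        ((((yPrmX n ℓ h v R' qB N).scheduleN 1 hσB 0 (yPrmX_ok hn hv hlay R' qB N) (yPrmX_eb n ℓ h v R' qB N)).R' : ℕ) : Site 2)))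
    (hcw : c ∈ graphBall G w₀ (R - r)) (hr : Rl ≤ r) (hrR : r ≤ R) {Z : Finset V} (hZ : (↑Z : Set V) ⊆ cyl φ c Mz)
    (hclear : (Mz + 4) * (n + h.natAbs) ≤ n * (ℓ + 1))
    {Dr T : Finset V}
    (hPD : Win G (runX φ c₀ n h 1) w₀
      (((yPrmX n ℓ h v R' qB N).scheduleN 1 hσB 0 (yPrmX_ok hn hv hlay R' qB N) (yPrmX_eb n ℓ h v R' qB N)).region k) R ⊆ Dr)
    (hPT : Win G (runX φ c₀ n h 1) w₀
      (((yPrmX n ℓ h v R' qB N).scheduleN 1 hσB 0 (yPrmX_ok hn hv hlay R' qB N) (yPrmX_eb n ℓ h v R' qB N)).core (k + 1)) R ⊆ T)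
    {Ω : Finset V} (hDrΩ : Dr ⊆ Ω) {q : unitInterval} {Wt : Sym2 V → unitInterval} (hWD : IsSubbox (winGraphIn G Ω) Wt q Dr) {SEED : Finset V} {δ₂ : ℝ}
    (hev : 1 - δ₂ < (bondPercolation G q).real (linkIn (pgramPrism G φ c n h (3 * ℓ) Rl) SEED
      (pgTopPieceW G φ c n h ℓ Rl σB ((yPrmX n ℓ h v R' qB N).steer k (σB * runX φ c₀ n h 1 c 0)) v))) :
    ∃ Qt Ft : Finset V, Ft ⊆ T ∧ Qt ⊆ Dr ∧ Disjoint Ft Z ∧ 1 - δ₂ < (prodBernoulli Wt).real (linkIn (↑Qt : Set V) SEED Ft) := by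
  set τ₀ := (yPrmX n ℓ h v R' qB N).steer k (σB * runX φ c₀ n h 1 c 0) with hτ₀
  have hQB : ∀ w ∈ pgramPrism G φ c n h (3 * ℓ) Rl, w ∈ graphBall G w₀ R := fun w hw =>
    pgramPrism_subset_graphBall_of_mem hcw hr hrR n h (3 * ℓ) hw
  have hQD : pgramPrismFin G φ c n h (3 * ℓ) Rl ⊆ Dr := fun w hw => by
    have hw' := (mem_pgramPrismFin G φ).1 hw
    exact hPD ((mem_Win G _).2 ⟨hQB w hw', runX_mem_ybandRegion_of_link hn hv hlay c₀ hσB R' qB N hc hw'⟩)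
  have hFt : (↑(pgTopPieceW G φ c n h ℓ Rl σB τ₀ v) : Set V) ⊆ pgramPrism G φ c n h (3 * ℓ) Rl := coe_pgTopPieceW_subset (G := G) (φ := φ) c n h ℓ Rl σB τ₀ v
  refine ⟨pgramPrismFin G φ c n h (3 * ℓ) Rl, pgTopPieceW G φ c n h ℓ Rl σB τ₀ v, fun w hw => ?_, hQD, ?_,
    transfer_prismFin hQD hDrΩ hWD SEED _ hFt hev⟩
  · have hw' : w ∈ pgramPrism G φ c n h (3 * ℓ) Rl := hFt (Finset.mem_coe.2 hw)
    exact hPT ((mem_Win G _).2 ⟨hQB w hw', runX_mem_ybandCore_succ_of_piece hn hv hlay c₀ hσB R' qB N hc hw⟩)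
  · have hd := disjoint_pgTopPieceW_cyl (G := G) (φ := φ) c hn hclear Rl hσB τ₀ v
    exact Finset.disjoint_left.2 fun w hw hz => Set.disjoint_left.1 hd (Finset.mem_coe.2 hw) (hZ (Finset.mem_coe.2 hz))

end Skelφ

end Summit.CriticalPhenomena.PercolationContinuityZ3.Theorems.Transplant

end
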